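import Summits.ABC.IUTFork.Joshi.BundlingRingsCrossNorm
import Summits.ABC.IUTFork.Joshi.BundlingRingsPrototype
import Summits.ABC.IUTFork.Joshi.BundlingRingsFixedRho
import Summits.ABC.IUTFork.Joshi.TensorNormsNonArchCross
import Literature.Topology.Algebra.UltrametricNormRescale

/-!
# Joshi's Thm. 7.7.3.1 at one prime with BOTH printed inputs discharged in kernel
# (ultrametric factors over any complete non-archimedean field; the prototype-built datum on the literal tensor ring)

Proof-only companion (0 defs, nothing asserted) of `Joshi/BundlingRings.lean` (p429549), `Joshi/BundlingRingsCrossNorm.lean`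
(p430037), `Joshi/BundlingRingsPrototype.lean` (p431460) and `Joshi/BundlingRingsFixedRho.lean` (p431881) — block E of the abc-iut
cell (rung LADDER-ABC:A2.E; seat abc-iut-E-t13, slot T-13; AUTHORS-FIRST derivable rows of the seat's own files). SOURCE:
K. Joshi, *Construction of Arithmetic Teichmüller Spaces III*, arXiv:2401.13508v4 (`Joshi2024ATS3`; UNREFEREED, disputed in
print), Thm. 7.7.3.1 and its proof, p. 66 l. 62 – p. 67 l. 47, whose two inputs are (7.7.3.3) «By [Joshi, 2023b, Theorem 9.2.1]
… `Θ̃^{B̆}_{Joshi,p}` contains a pure tensor `⊗_{w|p} Z_w` such that `|Z_w|_{B_{E′_w},ρ} ≥ |q_w^{1/2ℓ}|`» and (7.7.3.2) «Lemma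
7.6.4.1, Lemma 7.6.5.1 show that `|⊗_{w|p} Z_w|_ρ = ∏_{w|p} |Z_w|_ρ`» (the cross-norm property, Thm. 7.6.2.2 (3)/(4) =
[Schneider 2002, Prop. 17.4]).

STATE OF THE CHAIN BEFORE THIS FILE. `BundlingRings` DERIVED Thm. 7.7.3.1 at `p` from the two inputs as hypotheses
(`localFundamentalEstimate_of_pilot_of_crossNorm`); `BundlingRingsPrototype` discharged (7.7.3.3) for the datum `ofPrototypes`
built from E-t3's typed [Joshi 2023b] prototype data (`pilotLowerBoundAt_ofPrototypes`), leaving (7.7.3.2);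
`BundlingRingsCrossNorm` reduced (7.7.3.2) for the literal projective-norm datum `ofProjective` to E-t14's `TensorNorm.HasCrossNorm`
and, over `ℚ_p`, to E-t14's claim-Prop `CrossNormClaimQp p` — which E-t14 has since REFUTED AS TYPED
(`TensorNorm.not_crossNormClaimQp`, `Joshi/TensorNormsCrossNormLimits.lean`: it quantifies over all Banach `ℚ_p`-spaces, and the
non-ultrametric quotient `ℓ¹(ℚ_p³)/diag` breaks it), so `localFundamentalEstimate_of_crossNormClaimQp` (p430037) has an
UNSATISFIABLE hypothesis and carries no content; abc-iut-found (`Joshi/TensorNormsNonArchUltrametric.lean`, p431820) then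
discharged (7.7.3.2) for `ofProjective` over `ℚ_p` with ULTRAMETRIC factors (`crossNormAt_of_ultrametric`, Ingleton route), and
E-t14 PROVED [Schneider 2002, Prop. 17.4] over EVERY complete non-archimedean field (`TensorNorm.hasCrossNorm_norm_of_ultrametric`,
`Joshi/TensorNormsNonArchCross.lean`, p432495).

WHAT THIS FILE ADDS (all PROVED, kernel compositions of the landed theorems BY NAME):
1. `sizeAt_locusTensor_ge_ofProjective_ultrametric` — Thm. 7.7.3.1 at `p` in the contentful FIXED-`ρ` form of
   `BundlingRingsFixedRho` for the literal datum over ANY complete non-archimedean nontrivially normed field `𝕜` and ultrametric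
   normed factors, modulo the pilot lower bound only ((7.7.3.2) discharged by `crossNormAt_ofProjective … (E-t14's
   hasCrossNorm_norm_of_ultrametric)`; the `CrossNormAt` / `LocalFundamentalEstimate` forms over general `𝕜` are that one-liner and
   are not re-recorded, abc-iut-found's `ℚ_[p]` forms being in the tree). WHY THE GENERAL `𝕜` MATTERS (faithfulness, numbers):
   Joshi's factor norm is the Fargues–Fontaine Fréchet norm `|−|_{B;ρ}` at a FIXED `ρ ∈ (0,1]` ([FF18, Déf. 1.4.1]:
   `|Σ [x_n] p^n|_ρ = sup |x_n| ρ^n`), whose restriction to `ℚ_p` is `|p|_ρ = ρ`; Mathlib's `NormedAlgebra ℚ_[p]` forces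
   `‖p • x‖ = p⁻¹ ‖x‖`, i.e. `ρ = 1/p`. For every other `ρ` the base field with the literal instances is the RESCALED field
   `(ℚ_p, |−|_p^c)`, `ρ = p^{-c}` — the tree's `NormRescale ℚ_[p] c` (`Literature/Topology/Algebra/UltrametricNormRescale.lean`)
   — which is complete and ultrametric but is not `ℚ_[p]`: `localFundamentalEstimate_ofPrototypes_padicRescale` records that
   instantiation (`norm_p_normRescale`: `‖p‖ = p^{-c}` there).
2. `crossNormAt_ofPrototypes_of_norm_eq` / `sizeAt_locusTensor_ge_ofPrototypes_of_norm_eq` /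
   `localFundamentalEstimate_ofPrototypes_of_norm_eq` — **Thm. 7.7.3.1 at `p` with BOTH inputs discharged**: for the datum
   `ofPrototypes` (factor norms, loci and `|q_w^{1/2ℓ}|` = those of E-t3 prototype data `P w`, one per `w | p`) on Joshi's LITERAL
   tensor ring `⨂[𝕜] w, B_{E′_w}` with the pure-tensor map `PiTensorProduct.tprodMonoidHom` and the projective norm, the estimate
   `∏_{w ∈ 𝕍^{odd,ss}_p} |q_w^{1/2ℓ}|^{ℓ⋇} ≤ |Θ̃^{B̆⊗}_{Joshi,p}|_{B̆⊗,ρ} ≤ |Θ̃^{B̆⊗}_{Joshi,p}|_{B̆⊗}` follows from: a canonical ansatz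
   point of each `P w` ([Joshi 2023b] Thm. 9.2.1's datum, E-t3's `CanonicalPoint`) and the identification, at the chosen `ρ`, of the
   prototype's Fréchet norm `(P w).norm ρ` with an ultrametric Banach `𝕜`-algebra norm on `B_{E′_w}` (`hn`). No claim-Prop of the
   disputed source remains among the hypotheses; what remains is E-t3's SIGNATURE (the [FF18] facts recorded as fields of
   `PeriodRingDatum` / `PrototypeDatum`) and `hn`.

HONEST LIMITS (for E-ref / E-cx). (a) ONE `ρ`: as in p430037, Mathlib's `‖·‖` on `B_{E′_w}` is one Banach norm, so `hn` ties
it to the Fréchet norm at the single `ρ` used — this is exactly how print uses the inputs («for each `0 < ρ < 1` … (7.7.3.3)», p. 67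
l. 1–13; (7.7.3.2) at the same `ρ`). (b) NON-VACUITY of item 2's hypotheses is NOT shown here: E-t3's O1 model
(`Joshi/TestThetaValuesLocusModel.lean`, p432971) realises `PrototypeDatum` + `CanonicalPoint` with `B := (Q̄_p → Q̄_p)` and the
`ρ`-independent evaluation SEMInorm `f ↦ ‖f(p)‖`, which is not a norm, so it does not supply `hn`; item 1's hypotheses are
satisfiable by `Joshi/BundlingRingsModel.lean` (p429810)-style data. (c) UNCOMPLETED tensor product, as in print (p. 65 l. 36–37).
No side taken on [IUTchIII] Cor. 3.12, on Joshi's claims or on Mochizuki's reports; typed ≠ proved ≠ endorsed; nothing here binds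
the cell's frozen interface. Standard axioms; sorry-free; no instance, notation or definition is declared.
-/

noncomputable section

open Set
open scoped TensorProduct

namespace Summit.ABC.IUTFork.Joshi

namespace ATS3.PrimeBundlingDatum

/-! ## 1. The literal projective datum over a complete non-archimedean field with ultrametric factors -/

section Projective

variable {lstar : ℕ} {𝕜 Bp : Type} [NontriviallyNormedField 𝕜] [CompleteSpace 𝕜] [IsUltrametricDist 𝕜] [CommRing Bp]
  [Algebra 𝕜 Bp] {I : Type} [Fintype I] [DecidableEq I] {E BE : I → Type} [∀ w, Field (E w)] [∀ w, Algebra 𝕜 (E w)]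
  [∀ w, NormedCommRing (BE w)] [∀ w, NormedAlgebra 𝕜 (BE w)] [∀ w, Algebra Bp (BE w)] [∀ w, IsUltrametricDist (BE w)]
  (Vp Vss : Finset I) (hV : Vss ⊆ Vp) (toTensE : (w : I) → BE w →ₗ[𝕜] Bp ⊗[𝕜] E w)
  (locusBE : (w : I) → Set (Fin lstar → BE w)) (qRoot : I → ℝ) (hq : ∀ w ∈ Vss, 0 < qRoot w)

/-- **Thm. 7.7.3.1 at `p`, FIXED-`ρ` form, modulo the pilot lower bound only** (literal projective datum, ultrametric factors, ANY
complete non-archimedean base field `𝕜`): the per-`w` pilot lower bound (7.7.3.3) at a real `ρ` gives `∏_{w ∈ 𝕍^{odd,ss}_p}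
|q_w^{1/2ℓ}|^{ℓ⋇} ≤ |Θ̃^{B̆⊗}_{Joshi,p}|_{B̆⊗,ρ}` (the size (7.2.8) AT `ρ`, `BundlingRingsFixedRho`), the cross-norm input (7.7.3.2) being
DISCHARGED at every `ρ` by E-t14's PROVED [Schneider 2002, Prop. 17.4] (`crossNormAt_ofProjective … hasCrossNorm_norm_of_ultrametric`;
over `𝕜 = ℚ_[p]` this discharge is abc-iut-found's `crossNormAt_of_ultrametric` / `localFundamentalEstimate_of_ultrametric`, whose
statements the general-`𝕜` forms would duplicate, so only the fixed-`ρ` form is recorded here). [folklore] -/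
theorem sizeAt_locusTensor_ge_ofProjective_ultrametric {ρ : ℝ}
    (hZ : (ofProjective Vp Vss hV toTensE locusBE qRoot hq).PilotLowerBoundAt ρ) :
    (((∏ w ∈ Vss, qRoot w ^ lstar : ℝ) : ℝ) : EReal) ≤
      (ofProjective Vp Vss hV toTensE locusBE qRoot hq).sizeAt
        (ofProjective Vp Vss hV toTensE locusBE qRoot hq).locusTensor ρ :=
  (ofProjective Vp Vss hV toTensE locusBE qRoot hq).sizeAt_locusTensor_ge_of_pilot_of_crossNorm hZ
    (crossNormAt_ofProjective Vp Vss hV toTensE locusBE qRoot hq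
      (TensorNorm.hasCrossNorm_norm_of_ultrametric (𝕜 := 𝕜) (V := fun w : Vss => BE w.1)) ρ)

end Projective

/-! ## 2. The prototype-built datum on the literal tensor ring: BOTH inputs discharged -/

section Prototypes

variable {lstar : ℕ} {𝕜 Bp : Type} [NontriviallyNormedField 𝕜] [CompleteSpace 𝕜] [IsUltrametricDist 𝕜] [CommRing Bp]
  [Algebra 𝕜 Bp] {I : Type} [Fintype I] [DecidableEq I] {E BE : I → Type} [∀ w, Field (E w)] [∀ w, Algebra 𝕜 (E w)]
  [∀ w, NormedCommRing (BE w)] [∀ w, NormedAlgebra 𝕜 (BE w)] [∀ w, Algebra Bp (BE w)] [∀ w, IsUltrametricDist (BE w)]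
  {F E0 : I → Type} [∀ w, Field (F w)] [∀ w, Field (E0 w)] {Y : I → Type} {K : (w : I) → Y w → Type}
  [∀ w y, Field (K w y)] {G : I → Type}
  (P : (w : I) → PrototypeDatum (F w) (BE w) (E0 w) (Y w) (K w) (G w)) (hl : ∀ w, (P w).lstar = lstar)
  (Vp Vss : Finset I) (hV : Vss ⊆ Vp) (toTensE : (w : I) → BE w →ₗ[𝕜] Bp ⊗[𝕜] E w)

/-- **(7.7.3.2) DISCHARGED for the prototype-built datum on the literal tensor ring**: if, at the real `ρ`, the Fréchet norm
`(P w).norm ρ` of each prototype datum over `w ∈ 𝕍^{odd,ss}_p` IS the ultrametric Banach `𝕜`-algebra norm of `B_{E′_w}` (`hn`), then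
`ofPrototypes` with tensor ring `⨂[𝕜] w, B_{E′_w}`, pure-tensor map `tprodMonoidHom` and the projective tensor norm has
`CrossNormAt ρ` — by E-t14's PROVED [Schneider 2002, Prop. 17.4]. [folklore] -/
theorem crossNormAt_ofPrototypes_of_norm_eq {ρ : ℝ} (hn : ∀ w ∈ Vss, ∀ x : BE w, (P w).norm ρ x = ‖x‖) :
    (ofPrototypes P hl Vp Vss hV toTensE (PiTensorProduct.tprodMonoidHom 𝕜)
      (fun _ (t : PiTensorProduct 𝕜 fun w : Vss => BE w.1) => ‖t‖) (fun _ t => norm_nonneg t)).CrossNormAt ρ := by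
  intro x
  show ‖(PiTensorProduct.tprodMonoidHom 𝕜) x‖ = ∏ w : Vss, (P w.1).norm ρ (x w)
  rw [Finset.prod_congr rfl fun (w : Vss) _ => hn w.1 w.2 (x w)]
  exact TensorNorm.hasCrossNorm_norm_of_ultrametric (𝕜 := 𝕜) (V := fun w : Vss => BE w.1) x

/-- **Thm. 7.7.3.1 at `p`, FIXED-`ρ` form, BOTH INPUTS DISCHARGED**: for the prototype-built datum on the literal tensor ring,
a canonical ansatz point of each `P w` ([Joshi 2023b] Thm. 9.2.1, member form — E-t3's signature; discharges (7.7.3.3) via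
`pilotLowerBoundAt_ofPrototypes`) and the norm identification `hn` at a `ρ ∈ (0,1]` (discharges (7.7.3.2) via E-t14's theorem) give
`∏_{w ∈ 𝕍^{odd,ss}_p} |q_w^{1/2ℓ}|^{ℓ⋇} ≤ |Θ̃^{B̆⊗}_{Joshi,p}|_{B̆⊗,ρ}`. No claim-Prop of the disputed source is a hypothesis. [folklore] -/
theorem sizeAt_locusTensor_ge_ofPrototypes_of_norm_eq (c : ∀ w, (P w).CanonicalPoint) {ρ : ℝ} (hρ : 0 < ρ) (hρ1 : ρ ≤ 1)
    (hn : ∀ w ∈ Vss, ∀ x : BE w, (P w).norm ρ x = ‖x‖) :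
    (((∏ w ∈ Vss, (P w).abs0 (P w).xi ^ lstar : ℝ) : ℝ) : EReal) ≤
      (ofPrototypes P hl Vp Vss hV toTensE (PiTensorProduct.tprodMonoidHom 𝕜)
          (fun _ (t : PiTensorProduct 𝕜 fun w : Vss => BE w.1) => ‖t‖) (fun _ t => norm_nonneg t)).sizeAt
        (ofPrototypes P hl Vp Vss hV toTensE (PiTensorProduct.tprodMonoidHom 𝕜)
          (fun _ (t : PiTensorProduct 𝕜 fun w : Vss => BE w.1) => ‖t‖) (fun _ t => norm_nonneg t)).locusTensor ρ :=
  PrimeBundlingDatum.sizeAt_locusTensor_ge_of_pilot_of_crossNorm _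
    (pilotLowerBoundAt_ofPrototypes P hl Vp Vss hV toTensE _ _ _ c hρ hρ1)
    (crossNormAt_ofPrototypes_of_norm_eq P hl Vp Vss hV toTensE hn)

/-- **THEOREM 7.7.3.1 AT `p` WITH BOTH PRINTED INPUTS DISCHARGED IN KERNEL** ((7.2.9)-size form `LocalFundamentalEstimate`):
for the §7.5/§7.7 datum whose factor norms, local theta-values loci and `|q_w^{1/2ℓ}|` are those of E-t3 prototype data `P w`
(`w | p`) and whose tensor ring is Joshi's literal `B̆⊗_{L′,p} = ⨂[𝕜] w B_{E′_w}` with the projective norm, canonical ansatz points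
`c w` and the norm identification `hn` at some `ρ ∈ (0,1]` imply `|Θ̃^{B̆⊗}_{Joshi,p}|_{B̆⊗} ≥ ∏_{w ∈ 𝕍^{odd,ss}_p} |q_w^{1/2ℓ}|^{ℓ⋇}`.
Inputs of print: (7.7.3.3) ← `PrototypeDatum.exists_mem_thetaLocus_pow_le` (E-t3's typed [Joshi 2023b] Thm. 9.2.1);
(7.7.3.2) ← `TensorNorm.hasCrossNorm_norm_of_ultrametric` (E-t14, [Schneider 2002, Prop. 17.4] PROVED). Remaining trust base:
E-t3's signature fields and `hn`; non-vacuity of their conjunction not shown here (module docstring (b)). Typed ≠ endorsed.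
[folklore] -/
theorem localFundamentalEstimate_ofPrototypes_of_norm_eq (c : ∀ w, (P w).CanonicalPoint) {ρ : ℝ}
    (hρ : ρ ∈ Set.Ioc (0 : ℝ) 1) (hn : ∀ w ∈ Vss, ∀ x : BE w, (P w).norm ρ x = ‖x‖) :
    (ofPrototypes P hl Vp Vss hV toTensE (PiTensorProduct.tprodMonoidHom 𝕜)
      (fun _ (t : PiTensorProduct 𝕜 fun w : Vss => BE w.1) => ‖t‖) (fun _ t => norm_nonneg t)).LocalFundamentalEstimate :=
  PrimeBundlingDatum.localFundamentalEstimate_of_pilot_of_crossNorm _ hρ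
    (pilotLowerBoundAt_ofPrototypes P hl Vp Vss hV toTensE _ _ _ c hρ.1 hρ.2)
    (crossNormAt_ofPrototypes_of_norm_eq P hl Vp Vss hV toTensE hn)

end Prototypes

/-! ## 3. The `p`-adic instantiations: `ℚ_p` itself (`ρ = 1/p`) and the rescaled fields `(ℚ_p, |−|_p^c)` (`ρ = p^{-c}`) -/

section Padic

variable {lstar : ℕ} {p : ℕ} [Fact p.Prime] {c : ℝ} [Fact (0 < c)]

/-- `‖p‖ = p^{-c}` in the rescaled field `(ℚ_p, |−|_p^c)` — the normalisation `|p|_ρ = ρ` of the Fréchet norm `|−|_ρ`,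
`ρ = p^{-c}` ([FF18, Déf. 1.4.1]), realised by the tree's `NormRescale`. [folklore] -/
theorem norm_p_normRescale :
    ‖((NormRescale.equiv ℚ_[p] c).symm (p : ℚ_[p]))‖ = ((p : ℝ)⁻¹) ^ c := by
  rw [NormRescale.norm_equiv_symm, Padic.norm_p]

variable {Bp : Type} [CommRing Bp] [Algebra (NormRescale ℚ_[p] c) Bp] {I : Type} [Fintype I]
  [DecidableEq I] {E BE : I → Type} [∀ w, Field (E w)] [∀ w, Algebra (NormRescale ℚ_[p] c) (E w)]
  [∀ w, NormedCommRing (BE w)] [∀ w, NormedAlgebra (NormRescale ℚ_[p] c) (BE w)]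
  [∀ w, Algebra Bp (BE w)] [∀ w, IsUltrametricDist (BE w)]
  {F E0 : I → Type} [∀ w, Field (F w)] [∀ w, Field (E0 w)] {Y : I → Type} {K : (w : I) → Y w → Type}
  [∀ w y, Field (K w y)] {G : I → Type}
  (P : (w : I) → PrototypeDatum (F w) (BE w) (E0 w) (Y w) (K w) (G w)) (hl : ∀ w, (P w).lstar = lstar)
  (Vp Vss : Finset I) (hV : Vss ⊆ Vp)
  (toTensE : (w : I) → BE w →ₗ[NormRescale ℚ_[p] c]
    Bp ⊗[NormRescale ℚ_[p] c] E w)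

/-- **Thm. 7.7.3.1 at `p` over the rescaled base field `(ℚ_p, |−|_p^c)`** (`ρ = p^{-c}` normalisation; `c = 1` is `ℚ_p` up to the
synonym): the instance of `localFundamentalEstimate_ofPrototypes_of_norm_eq` in which completeness and ultrametricity of the base
field are SYNTHESISED (`NormRescale.instCompleteSpace`, `instIsUltrametricDist`, from Mathlib's `ℚ_[p]` instances) rather than
assumed. Both printed inputs discharged; hypotheses = canonical points + the norm identification `hn` at one `ρ ∈ (0,1]`.
[folklore] -/
theorem localFundamentalEstimate_ofPrototypes_padicRescale (cpt : ∀ w, (P w).CanonicalPoint) {ρ : ℝ}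
    (hρ : ρ ∈ Set.Ioc (0 : ℝ) 1) (hn : ∀ w ∈ Vss, ∀ x : BE w, (P w).norm ρ x = ‖x‖) :
    (ofPrototypes P hl Vp Vss hV toTensE
      (PiTensorProduct.tprodMonoidHom (NormRescale ℚ_[p] c))
      (fun _ (t : PiTensorProduct (NormRescale ℚ_[p] c) fun w : Vss => BE w.1) => ‖t‖)
      (fun _ t => norm_nonneg t)).LocalFundamentalEstimate :=
  localFundamentalEstimate_ofPrototypes_of_norm_eq P hl Vp Vss hV toTensE cpt hρ hn

end Padic

section PadicPlain

variable {lstar : ℕ} {p : ℕ} [Fact p.Prime] {Bp : Type} [CommRing Bp] [Algebra ℚ_[p] Bp] {I : Type} [Fintype I]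
  [DecidableEq I] {E BE : I → Type} [∀ w, Field (E w)] [∀ w, Algebra ℚ_[p] (E w)] [∀ w, NormedCommRing (BE w)]
  [∀ w, NormedAlgebra ℚ_[p] (BE w)] [∀ w, Algebra Bp (BE w)] [∀ w, IsUltrametricDist (BE w)]
  {F E0 : I → Type} [∀ w, Field (F w)] [∀ w, Field (E0 w)] {Y : I → Type} {K : (w : I) → Y w → Type}
  [∀ w y, Field (K w y)] {G : I → Type}
  (P : (w : I) → PrototypeDatum (F w) (BE w) (E0 w) (Y w) (K w) (G w)) (hl : ∀ w, (P w).lstar = lstar)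
  (Vp Vss : Finset I) (hV : Vss ⊆ Vp) (toTensE : (w : I) → BE w →ₗ[ℚ_[p]] Bp ⊗[ℚ_[p]] E w)

/-- **Thm. 7.7.3.1 at `p` over `ℚ_p` with the literal Mathlib instances** (normalisation `|p| = p⁻¹`, i.e. the Fréchet parameter
`ρ = 1/p` if `hn` is to be literal): both printed inputs discharged; this is the `ofPrototypes` counterpart of abc-iut-found's
`localFundamentalEstimate_of_ultrametric` (which keeps (7.7.3.3) as a hypothesis on `ofProjective`) and the NON-VACUOUS replacement
of p430037's `localFundamentalEstimate_of_crossNormClaimQp` (whose hypothesis `CrossNormClaimQp p` E-t14 refuted as typed).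
[folklore] -/
theorem localFundamentalEstimate_ofPrototypes_padic (cpt : ∀ w, (P w).CanonicalPoint) {ρ : ℝ}
    (hρ : ρ ∈ Set.Ioc (0 : ℝ) 1) (hn : ∀ w ∈ Vss, ∀ x : BE w, (P w).norm ρ x = ‖x‖) :
    (ofPrototypes P hl Vp Vss hV toTensE (PiTensorProduct.tprodMonoidHom ℚ_[p])
      (fun _ (t : PiTensorProduct ℚ_[p] fun w : Vss => BE w.1) => ‖t‖) (fun _ t => norm_nonneg t)).LocalFundamentalEstimate :=
  localFundamentalEstimate_ofPrototypes_of_norm_eq P hl Vp Vss hV toTensE cpt hρ hn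

end PadicPlain

end ATS3.PrimeBundlingDatum

end Summit.ABC.IUTFork.Joshi

end
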